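import Summits.CriticalPhenomena.PercolationContinuityZ3.Theorems.PercNearOneGluingNoHeavyQuantLawDecShift
import HarnessLib

/-!
# QUANT lane R8, T-DEC: CONJECTURE SL (slice closure of DEC) and the reduction BLOB-DEC(k) ∀ k ⟸ SL

builds on p205010 (kernel theorem, internal audit signed; external expert review pending)

Statement + support file (`--supports stmt-CriticalPhenomena-4575`), QUANT lane seat prim-quant-census-2 (gen 53), rung R8 of
`run/shared/lean/prim/quant/LADDER.md`.  Memo `run/shared/lean/prim/quant/prim-quant-census-2-g53/DEC-CLOSURE-G53.md` (§0 (1), §4).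
Three definitions (`LawDec.slice`, `LawDec.blobLaw`/`blobTop`/`blobMean` bookkeeping, the `@[conjecture]` `LawDec.SliceClosed`), theorems with
standard axioms, no sorries.

THE FINDING (census-2 g53, exact LP).  `Quant.LawDec.DECAt` ("DEC(j′)") is, on every instance tested, CLOSED UNDER THE ONE-BLOB SLICE:
if a top-affordable law `μ″` on `{0..M}` is DEC at layers `j′` and `j′ − a` (floor `x`), then for every gate `g ∈ [x, 1)` the law of
`S″ + a·ξ` (`ξ ~ Bernoulli(g)` independent), i.e. `h ↦ (1−g)·μ″ h + g·μ″(h−a)·[a ≤ h]`, is DEC at layer `j′` (its own mean `T″ + a g`) —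
0 failures on 771 860 (kit j130794) + 289 546 (kit j131196, adversarial E-tight laws at their largest DEC floor) + 25 278 (local) layers
satisfying both hypotheses; with the layer-`j′` hypothesis alone it is false (light pairs with `hi ∈ (j′−a, j′]`, memo §3.2).  Since the law of
`k` independent heavy blobs is `k` successive slices of `δ₀`, SL gives BLOB-DEC(k) (DEC-TAMP-G50 §3.7 / BLOB-DEC2-G51) at EVERY layer for
EVERY `k` by induction on `k` — proved here as `LawDec.blobDEC_of_sliceClosed`.  (Law-level GATE closure is FALSE — memo §2.3 — so the
analogous reduction of `Quant.TreeDEC` needs the gate-stable variant, memo §0 (4); not in this file.)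

* `LawDec.slice μ a g` — the slice `h ↦ (1−g)·μ h + g·μ(h−a)·[a ≤ h]`.
* `LawDec.blobLaw l` / `blobTop l` / `blobMean l` — the law of `Σ aᵢξᵢ` for a list `l` of blobs `(aᵢ, gᵢ)` (successive slices of `δ₀`),
  its top `Σ aᵢ` and mean `Σ aᵢgᵢ`; `blobLaw_nonneg`, `blobLaw_eq_zero`, `sum_blobLaw`, `sum_mul_blobLaw` (mean), `floor_mul_blobTop_le`.
* **`LawDec.SliceClosed`** (`@[conjecture]`) — SL as above.
* **`LawDec.blobDEC_of_sliceClosed : SliceClosed → ∀ x l, 0 < x → (∀ blobs: 1 ≤ a, x ≤ g < 1) → ∀ j′, DECAt x j′ (blobTop l) (blobLaw l)`.**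

[this work]; DEC rules ARCH-TREES-G49 §2.2 / DEC-TAMP-G50 §3.1 (this lane).  The gluing rows served [cite: KozmaNitzan2024, Conjecture 3 (p. 15)];
product measure [cite: Grimmett1999, §1.3 p. 10].
-/

noncomputable section

namespace Summit.CriticalPhenomena.PercolationContinuityZ3.Theorems

namespace Quant

open Finset

/-- the two-point law `{lo, hi; g}` (as in `…QuantLawDEC`) -/
local notation3 "TP[" lo ", " hi ", " g ", " h "]" =>
  (g : ℝ) * (if (h : ℕ) = (hi : ℕ) then (1 : ℝ) else 0) + (1 - (g : ℝ)) * (if (h : ℕ) = (lo : ℕ) then (1 : ℝ) else 0)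

namespace LawDec

/-! ### The slice and the blob laws -/

/-- **One-blob slice** of a law `μ` by a blob of size `a` at gate `g`: the law of `S + a·ξ`, `ξ ~ Bernoulli(g)` independent of `S ~ μ`,
i.e. `h ↦ (1−g)·μ h + g·μ(h−a)·[a ≤ h]`. [this work] -/
def slice (μ : ℕ → ℝ) (a : ℕ) (g : ℝ) : ℕ → ℝ :=
  fun h => (1 - g) * μ h + g * (if a ≤ h then μ (h - a) else 0)

/-- **Law of a finite list of independent heavy blobs** `(aᵢ, gᵢ)`: successive slices of `δ₀` (the head blob sliced last). [this work] -/
def blobLaw : List (ℕ × ℝ) → ℕ → ℝ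
  | [] => fun h => if h = 0 then 1 else 0
  | p :: l => slice (blobLaw l) p.1 p.2

/-- top atom `Σ aᵢ` of a blob list. [this work] -/
def blobTop : List (ℕ × ℝ) → ℕ
  | [] => 0
  | p :: l => blobTop l + p.1

/-- mean `Σ aᵢ gᵢ` of a blob list. [this work] -/
def blobMean : List (ℕ × ℝ) → ℝ
  | [] => 0
  | p :: l => blobMean l + (p.1 : ℝ) * p.2

/-- mass bookkeeping of a shift: `Σ_{h < M+s+1} ν(h−s)·[s ≤ h] = Σ_{k < M+1} ν k`. [folklore] -/
theorem sum_shift (ν : ℕ → ℝ) (M s : ℕ) :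
    ∑ h ∈ Finset.range (M + s + 1), (if s ≤ h then ν (h - s) else 0) = ∑ k ∈ Finset.range (M + 1), ν k := by
  rw [Finset.range_eq_Ico, ← Finset.sum_Ico_consecutive _ (Nat.zero_le s) (by omega : s ≤ M + s + 1)]
  have hzero : ∑ h ∈ Finset.Ico 0 s, (if s ≤ h then ν (h - s) else 0) = 0 := by
    refine Finset.sum_eq_zero fun h hh => ?_
    rw [Finset.mem_Ico] at hh
    rw [if_neg (by omega)]
  rw [hzero, zero_add, Finset.sum_Ico_eq_sum_range, show M + s + 1 - s = M + 1 by omega]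
  refine Finset.sum_congr rfl fun k _ => ?_
  rw [if_pos (Nat.le_add_right s k), Nat.add_sub_cancel_left]

/-- a sum over `range (M + a + 1)` of a function vanishing above `M` is the sum over `range (M + 1)`. [folklore] -/
theorem sum_range_extend (u : ℕ → ℝ) (M a : ℕ) (hu : ∀ h, M < h → u h = 0) :
    ∑ h ∈ Finset.range (M + a + 1), u h = ∑ h ∈ Finset.range (M + 1), u h := by
  rw [Finset.range_eq_Ico, Finset.range_eq_Ico,
    ← Finset.sum_Ico_consecutive _ (Nat.zero_le (M + 1)) (by omega : M + 1 ≤ M + a + 1)]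
  have : ∑ h ∈ Finset.Ico (M + 1) (M + a + 1), u h = 0 :=
    Finset.sum_eq_zero fun h hh => hu h (by rw [Finset.mem_Ico] at hh; omega)
  rw [this, add_zero]

/-- `blobLaw l ≥ 0` when all gates lie in `[0,1]`. [this work] -/
theorem blobLaw_nonneg (l : List (ℕ × ℝ)) (hl : ∀ p ∈ l, 0 ≤ p.2 ∧ p.2 ≤ 1) (h : ℕ) : 0 ≤ blobLaw l h := by
  induction l generalizing h with
  | nil => simp only [blobLaw]; split_ifs <;> norm_num
  | cons p l ih =>
    have hp := hl p (by simp)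
    have ih' := fun h => ih (fun q hq => hl q (by simp [hq])) h
    simp only [blobLaw, slice]
    refine add_nonneg (mul_nonneg (by linarith [hp.2]) (ih' h)) (mul_nonneg hp.1 ?_)
    split_ifs
    · exact ih' _
    · exact le_rfl

/-- `blobLaw l` vanishes above its top. [this work] -/
theorem blobLaw_eq_zero (l : List (ℕ × ℝ)) (h : ℕ) (hh : blobTop l < h) : blobLaw l h = 0 := by
  induction l generalizing h with
  | nil => simp only [blobLaw, blobTop] at hh ⊢; rw [if_neg (by omega)]
  | cons p l ih =>
    simp only [blobLaw, slice, blobTop] at hh ⊢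
    rw [ih h (by omega), mul_zero, zero_add]
    split_ifs with ha
    · rw [ih (h - p.1) (by omega), mul_zero]
    · rw [mul_zero]

/-- `blobLaw l` has mass `1` on `{0..blobTop l}`. [this work] -/
theorem sum_blobLaw (l : List (ℕ × ℝ)) : ∑ h ∈ Finset.range (blobTop l + 1), blobLaw l h = 1 := by
  induction l with
  | nil => simp [blobLaw, blobTop]
  | cons p l ih =>
    simp only [blobLaw, slice, blobTop]
    rw [Finset.sum_add_distrib, ← Finset.mul_sum, ← Finset.mul_sum, sum_shift (blobLaw l) (blobTop l) p.1,
      sum_range_extend (blobLaw l) (blobTop l) p.1 (fun h hh => blobLaw_eq_zero l h hh), ih]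
    ring

/-- the mean of `blobLaw l` is `blobMean l = Σ aᵢgᵢ`. [this work] -/
theorem sum_mul_blobLaw (l : List (ℕ × ℝ)) :
    ∑ h ∈ Finset.range (blobTop l + 1), (h : ℝ) * blobLaw l h = blobMean l := by
  induction l with
  | nil => simp [blobLaw, blobTop, blobMean]
  | cons p l ih =>
    simp only [blobLaw, slice, blobTop, blobMean]
    have e : ∀ h : ℕ, (h : ℝ) * ((1 - p.2) * blobLaw l h + p.2 * (if p.1 ≤ h then blobLaw l (h - p.1) else 0))
        = (1 - p.2) * ((h : ℝ) * blobLaw l h) + p.2 * ((h : ℝ) * (if p.1 ≤ h then blobLaw l (h - p.1) else 0)) := fun h => by ring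
    simp_rw [e]
    rw [Finset.sum_add_distrib, ← Finset.mul_sum, ← Finset.mul_sum, sum_mul_shift (blobLaw l) (blobTop l) p.1, sum_blobLaw,
      sum_range_extend (fun h => (h : ℝ) * blobLaw l h) (blobTop l) p.1 (fun h hh => by simp only [blobLaw_eq_zero l h hh, mul_zero]), ih]
    ring

/-- heavy blobs are top-affordable: `x·Σ aᵢ ≤ Σ aᵢgᵢ` when every gate is `≥ x`. [this work] -/
theorem floor_mul_blobTop_le (x : ℝ) (l : List (ℕ × ℝ)) (hl : ∀ p ∈ l, x ≤ p.2) : x * (blobTop l : ℝ) ≤ blobMean l := by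
  induction l with
  | nil => simp [blobTop, blobMean]
  | cons p l ih =>
    simp only [blobTop, blobMean, Nat.cast_add]
    have hp := hl p (by simp)
    have ih' := ih (fun q hq => hl q (by simp [hq]))
    nlinarith [hp, ih', (Nat.cast_nonneg p.1 : (0 : ℝ) ≤ p.1)]

/-! ### Conjecture SL and the reduction -/

/-- **CONJECTURE SL (slice closure of DEC; census-2 g53 DEC-CLOSURE-G53 §0 (1)).**  For a law `μ ≥ 0` on `{0..M}` (mass 1) that is
top-affordable at floor `0 < x` (`x·h ≤ mean` for charged `h`), a blob size `a ≥ 1`, a gate `x ≤ g < 1` and a layer `j′ < M + a`: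
if `μ` is DEC(j′) and (when `a ≤ j′`) DEC(j′ − a) at floor `x`, then the slice `LawDec.slice μ a g` (law of `S + a·ξ`) is DEC(j′) at floor `x`
(`Quant.LawDec.DECAt x j′ (M + a) (slice μ a g)`).  EVIDENCE (exact LP): 0 failures on 1 086 684 layers satisfying both hypotheses
(kit j130794, j131196; local exp6/exp7), incl. adversarial boundary laws; false without the second hypothesis.  The case `a > j′` is
criterion E (every atom of the shifted row is a giant, `x ≤ g`); the piecewise mechanisms and the open "band" point are memo §3.
[this work] [status: open] -/
@[conjecture] def SliceClosed : Prop :=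
  ∀ (x g : ℝ) (M a j' : ℕ) (μ : ℕ → ℝ),
    0 < x → x ≤ g → g < 1 → 1 ≤ a →
    (∀ h, 0 ≤ μ h) → (∀ h, M < h → μ h = 0) → (∑ h ∈ Finset.range (M + 1), μ h = 1) →
    (∀ h, 0 < μ h → x * (h : ℝ) ≤ ∑ k ∈ Finset.range (M + 1), (k : ℝ) * μ k) →
    j' < M + a →
    DECAt x j' M μ →
    (a ≤ j' → DECAt x (j' - a) M μ) →
    DECAt x j' (M + a) (slice μ a g)

/-- **DEC at every layer for the empty blob list** (`δ₀`, mean `0`): the single point component `{0}` is self-sufficient. [this work] -/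
theorem decAt_blobLaw_nil (x : ℝ) (j' : ℕ) : DECAt x j' (blobTop []) (blobLaw []) := by
  refine ⟨Unit, inferInstance, fun _ => 1, fun _ => 0, fun _ => 0, fun _ => 0, fun _ => zero_le_one, by simp,
    fun _ => ⟨le_rfl, zero_le_one⟩, fun _ => le_rfl, fun _ => le_rfl, fun h => ?_, fun _ _ => Or.inl ⟨rfl, Or.inl ?_⟩⟩
  · simp only [blobLaw, Finset.univ_unique, Finset.sum_singleton]
    split_ifs <;> ring
  · simp [blobTop, blobLaw]

/-- **BLOB-DEC(k) FOR EVERY k FROM CONJECTURE SL.**  If `SliceClosed` holds then, for every floor `0 < x` and every finite list of blobs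
with sizes `≥ 1` and gates in `[x, 1)`, the blob law is DEC(j′) at floor `x` for EVERY layer `j′` (layers `≥ Σaᵢ` by Theorem A, the others by
`k` applications of SL starting from `δ₀`). [this work] -/
theorem blobDEC_of_sliceClosed (hSL : SliceClosed) (x : ℝ) (hx0 : 0 < x) (hx1 : x < 1) :
    ∀ (l : List (ℕ × ℝ)), (∀ p ∈ l, 1 ≤ p.1 ∧ x ≤ p.2 ∧ p.2 < 1) → ∀ j', DECAt x j' (blobTop l) (blobLaw l) := by
  intro l
  induction l with
  | nil => exact fun _ j' => decAt_blobLaw_nil x j'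
  | cons p l ih =>
    intro hl j'
    have hp := hl p (by simp)
    have hl' : ∀ q ∈ l, 1 ≤ q.1 ∧ x ≤ q.2 ∧ q.2 < 1 := fun q hq => hl q (by simp [hq])
    have ih' := ih hl'
    have hgates : ∀ q ∈ l, 0 ≤ q.2 ∧ q.2 ≤ 1 := fun q hq => ⟨hx0.le.trans (hl' q hq).2.1, (hl' q hq).2.2.le⟩
    have hgates' : ∀ q ∈ p :: l, 0 ≤ q.2 ∧ q.2 ≤ 1 := fun q hq => ⟨hx0.le.trans (hl q hq).2.1, (hl q hq).2.2.le⟩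
    -- top-affordability of the tail law
    have htop : ∀ h, 0 < blobLaw l h → x * (h : ℝ) ≤ ∑ k ∈ Finset.range (blobTop l + 1), (k : ℝ) * blobLaw l k := by
      intro h hh
      rw [sum_mul_blobLaw]
      have hle : h ≤ blobTop l := by
        by_contra hlt
        exact absurd (blobLaw_eq_zero l h (not_le.1 hlt)) (ne_of_gt hh)
      have := floor_mul_blobTop_le x l (fun q hq => (hl' q hq).2.1)
      have hxh : x * (h : ℝ) ≤ x * (blobTop l : ℝ) := mul_le_mul_of_nonneg_left (by exact_mod_cast hle) hx0.le
      linarith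
    by_cases hj : j' < blobTop l + p.1
    · -- a genuine layer of the sliced law: conjecture SL
      exact hSL x p.2 (blobTop l) p.1 j' (blobLaw l) hx0 hp.2.1 hp.2.2 hp.1 (blobLaw_nonneg l hgates)
        (fun h hh => blobLaw_eq_zero l h hh) (sum_blobLaw l) htop hj (ih' j') (fun _ => ih' (j' - p.1))
    · -- layers at or above the top: Theorem A
      have htop' : ∀ h, 0 < blobLaw (p :: l) h →
          x * (h : ℝ) ≤ ∑ k ∈ Finset.range (blobTop (p :: l) + 1), (k : ℝ) * blobLaw (p :: l) k := by
        intro h hh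
        rw [sum_mul_blobLaw]
        have hle : h ≤ blobTop (p :: l) := by
          by_contra hlt
          exact absurd (blobLaw_eq_zero (p :: l) h (not_le.1 hlt)) (ne_of_gt hh)
        have := floor_mul_blobTop_le x (p :: l) (fun q hq => (hl q hq).2.1)
        have hxh : x * (h : ℝ) ≤ x * (blobTop (p :: l) : ℝ) := mul_le_mul_of_nonneg_left (by exact_mod_cast hle) hx0.le
        linarith
      exact decAt_of_top_le (blobTop (p :: l)) (blobLaw (p :: l)) (blobLaw_nonneg (p :: l) hgates')
        (fun h hh => blobLaw_eq_zero (p :: l) h hh) (sum_blobLaw (p :: l)) x hx1 htop' j' (not_lt.1 hj)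

end LawDec

end Quant

end Summit.CriticalPhenomena.PercolationContinuityZ3.Theorems
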